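import Summits.Ventures.PercRepro.SixFourIdentities
import Summits.Ventures.PercRepro.PlaneCore

/-!
# PercRepro — C-025 at `(6,4)`: the demand-free cases of the per-solid balance at `t = 4` (p2, gen 8)

mine-2's `MINE2-RLS.md` §21.18 (the trivial clauses of Theorem 22″): when every rank-`4` subset `B ⊆ G` leaves a
rest `G ∖ B` of rank `≤ 3`, `DF₄ = N₄` and `J₄(G) = 2·Σ_{B ∈ R₄} w_∞(B) ≥ 0` (`J_four_nonneg_of_demandFree`).  This
covers the solids with `g ≤ 7` points (`|G ∖ B| ≤ 3`; `J_four_nonneg_of_card_le_seven`) and the «plane + one point»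
solids — a plane trace with `g − 1` points (§21.18.3 (β), `k = 1`: the point off the plane lies in every rank-`4`
subset, so the rest lies in the plane; `J_four_nonneg_of_plane_add_one`).  Both are clauses of the `g ≤ 9` piece
of `SixFourResidue` (with the generic (α) and plane-line (γ) halves and Theorem 21.6 at `k = 2`).
-/

namespace PercRepro.SixFour

open Finset ThmH

variable {α : Type*} [DecidableEq α] {M : Matroid α} [M.Finite] {G : Finset α}

/-- **The demand-free case**: if every rank-`4` subset of `G` leaves a rest of rank `≤ 3`, then `0 ≤ J₄(G)`. -/
theorem J_four_nonneg_of_demandFree (h : ∀ B ∈ R4 M G, M.eRk ((G \ B : Finset α) : Set α) ≤ 3) :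
    0 ≤ J M G 4 := by
  have hDF : DF M G 4 = N4 M G := by
    unfold DF N4
    congr 1
    apply Finset.filter_true_of_mem
    intro B hB
    have h3 := h B hB
    calc M.eRk ((G \ B : Finset α) : Set α) + 1 ≤ 3 + 1 := add_le_add_left h3 1
      _ = ((4 : ℕ) : ℕ∞) := by norm_num
  unfold J
  rw [hDF, sub_self, mul_zero, sub_zero]
  apply Finset.sum_nonneg
  intro B _
  have := wInf_pos (M := M) B
  norm_num
  linarith

omit [DecidableEq α] [M.Finite] in
/-- A finset of at most `3` points has rank `≤ 3`. -/
theorem eRk_le_three_of_card_le {X : Finset α} (hX : X.card ≤ 3) : M.eRk (X : Set α) ≤ 3 := by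
  have h := M.eRk_le_encard (X : Set α)
  rw [Set.encard_coe_eq_coe_finsetCard] at h
  exact h.trans (by exact_mod_cast hX)

/-- **`g ≤ 7`**: a rank-`4` subset has `≥ 4` points, so the rest has `≤ 3` points and rank `≤ 3`. -/
theorem J_four_nonneg_of_card_le_seven (hg : G.card ≤ 7) : 0 ≤ J M G 4 := by
  apply J_four_nonneg_of_demandFree
  intro B hB
  obtain ⟨hBG, hr⟩ := mem_R4.1 hB
  have h4 := four_le_card_of_eRk_eq_four hr
  apply eRk_le_three_of_card_le
  rw [Finset.card_sdiff_of_subset hBG]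
  omega

/-- **Plane + one point (§21.18.3, `k = 1`)**: if some plane trace has `g − 1` points, the point off the plane lies
in every rank-`4` subset `B ⊆ G`, so `G ∖ B` lies in the plane and has rank `≤ 3`. -/
theorem J_four_nonneg_of_plane_add_one {P : Finset α} (hP : P ∈ planes M) (hcard : (P ∩ G).card + 1 = G.card) :
    0 ≤ J M G 4 := by
  apply J_four_nonneg_of_demandFree
  intro B hB
  obtain ⟨hBG, hr⟩ := mem_R4.1 hB
  -- `G ∖ P` is a single point `v`
  have hGP : (G \ P).card = 1 := by
    have := Finset.card_sdiff_add_card_inter G P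
    rw [Finset.inter_comm] at this
    omega
  obtain ⟨v, hv⟩ := Finset.card_eq_one.1 hGP
  -- `v ∈ B`: otherwise `B ⊆ P ∩ G` has rank `≤ 3`
  have hvB : v ∈ B := by
    by_contra hvB
    have hBP : B ⊆ P := by
      intro b hb
      by_contra hbP
      have : b ∈ G \ P := Finset.mem_sdiff.2 ⟨hBG hb, hbP⟩
      rw [hv, Finset.mem_singleton] at this
      exact hvB (this ▸ hb)
    have h3 : M.eRk (B : Set α) ≤ 3 := by
      rw [← (mem_planes.1 hP).2.2]
      exact M.eRk_mono (Finset.coe_subset.2 hBP)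
    rw [hr] at h3
    exact absurd h3 (by decide)
  -- `G ∖ B ⊆ P`
  have hsub : G \ B ⊆ P := by
    intro b hb
    rw [Finset.mem_sdiff] at hb
    by_contra hbP
    have : b ∈ G \ P := Finset.mem_sdiff.2 ⟨hb.1, hbP⟩
    rw [hv, Finset.mem_singleton] at this
    exact hb.2 (this ▸ hvB)
  rw [← (mem_planes.1 hP).2.2]
  exact M.eRk_mono (Finset.coe_subset.2 hsub)

end PercRepro.SixFour
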